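import Summits.AnomalousDissipation.AnomalousDissipation.Theses.CoherentStates
import Literature.Analysis.FluidPDE.LongTimeAveragePeriodic
import Literature.Analysis.FunctionSpaces.TorusFourierCalculus

/-!
# AnomalousDissipation / CoherentStates — support item `SteadyImpliesCoherent`

Route `AnomalousDissipation/CoherentStates`, item stmt-AnomalousDissipation-10872 (`SteadyImpliesCoherent`,
support, rank 9): the second-layer glue `SteadyZerothLaw → CoherentThesis` of the two-layer plan, so that
the rank-2 crux `SteadyZerothLaw` (stmt-0219) closes the route through the deciding theorem `closes`.

Proof (pure bookkeeping, Doering–Foias 2002 §2 for the long-time averages): a steady classical solution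
`u j` is the time-constant space–time field `fun _ => u j`, which is `1`-periodic (`Function.Periodic _ 1`
by `rfl`), so take `τ j := 1`. For a `1`-periodic field the limsup long-time averages are period averages
(`Literature.Analysis.FluidPDE.meanEnergy_eq_of_periodic` / `meanDissipation_eq_of_periodic`), and the
period average of a constant is the constant: `meanEnergy (fun _ => u j) = ∫ ‖u j x‖²` and
`meanDissipation (ν j) (fun _ => u j) = ν j * (eGradNormSq (u j)).toReal`. Finally the spectral and the
pointwise squared gradient norms agree on smooth fields
(`Literature.Analysis.FunctionSpaces.Torus.gradNormSq_eq_toReal_eGradNormSq_holds`, Grafakos 2014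
Prop. 3.2.6), `u j` being smooth as the time-`0` slice of a classical solution on `univ`
(`IsClassicalNSSolutionOn.smooth_velocity`, `IsSmoothSpaceTimeOn.isSmooth_slice`).

Nothing else is used; no estimate uniform in `ν` enters.
-/

-- `Summit.<Summit>.<Problem>` is the tree's mandated summit-side namespace (CONVENTIONS §2); for this
-- single-conjunct summit the two coincide, so the duplicate is deliberate.
set_option linter.dupNamespace false

namespace Summit.AnomalousDissipation.AnomalousDissipation.Theorems

open MeasureTheory
open Literature.Analysis.FluidPDE Literature.Analysis.FunctionSpaces
open Summit.AnomalousDissipation.AnomalousDissipation.Theses.CoherentStates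

/-- Settles stmt-AnomalousDissipation-10872 (support item `SteadyImpliesCoherent` of route
CoherentStates): `SteadyZerothLaw → CoherentThesis`. Given the steady witnesses `f, ν, u, p` of
`SteadyZerothLaw`, the coherent-state witnesses are the same force and viscosities, periods
`τ j := 1`, and the time-constant fields `fun _ => u j`, `fun _ => p j`; the mean energy of a
time-constant field is `∫ ‖u j x‖²` and its mean dissipation is `ν j * gradNormSq (u j)`
(period averages of constants, `meanEnergy_eq_of_periodic` / `meanDissipation_eq_of_periodic`,
and `Torus.gradNormSq_eq_toReal_eGradNormSq_holds` on the smooth slice `u j`), so the energy and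
dissipation clauses transfer verbatim. [folklore] -/
theorem steadyImpliesCoherent_proof :
    Summit.AnomalousDissipation.AnomalousDissipation.Theses.CoherentStates.SteadyImpliesCoherent := by
  unfold SteadyImpliesCoherent
  intro h
  obtain ⟨f, hf, hdiv, hmean, ν, u, p, hν, hν0, hsol, ⟨E, hE⟩, ε, hε, hεle⟩ := h
  refine ⟨f, hf, hdiv, hmean, ν, fun _ => 1, fun j _ => u j, fun j _ => p j, hν, hν0,
    fun j => ⟨hsol j, one_pos, fun _ => rfl⟩, ⟨E, fun j => ?_⟩, ε, hε, fun j => ?_⟩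
  · -- mean energy of the time-constant field `fun _ => u j` is `∫ ‖u j x‖²`
    rw [meanEnergy_eq_of_periodic (τ := 1) (fun _ => rfl) one_pos]
    simpa using hE j
  · -- mean dissipation of the time-constant field is `ν j * gradNormSq (u j)` (smooth slice)
    have hsm : Torus.IsSmooth (u j) :=
      (hsol j).smooth_velocity.isSmooth_slice (Set.mem_univ (0 : ℝ))
    rw [meanDissipation_eq_of_periodic (τ := 1) (fun _ => rfl) one_pos]
    simpa [← Torus.gradNormSq_eq_toReal_eGradNormSq_holds hsm] using hεle j

end Summit.AnomalousDissipation.AnomalousDissipation.Theorems
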